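import Mathlib.LinearAlgebra.Matrix.Determinant.Basic
import Mathlib.LinearAlgebra.Matrix.Notation
import Mathlib.Analysis.Complex.Basic
import Mathlib.Tactic.FinCases
import Mathlib.Tactic.Ring

/-!
# Similarity covariance of the Delaunay cocircularity determinant

Helper for crux stmt-CriticalPhenomena-7029
(`Summit.CriticalPhenomena.CardyFormulaZ2.Theses.CardyFlipRusso.QuadrupoleSelectionRule`),
line Sketch, stub S6 (card C `poisson-hub-ward-identity`, "similarities flip no Delaunay
quadrilateral").

The Delaunay/cocircularity form of four points `z₀, …, z₃ ∈ ℂ` is the `4 × 4` determinant with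
rows `(Re zᵢ, Im zᵢ, |zᵢ|², 1)`.  Under a similarity `w ↦ a w + c` of the plane the matrix of the
transformed points is the matrix of the original points multiplied on the right by the explicit
matrix

  `!![Re a, Im a, 2 (Re a Re c + Im a Im c), 0; -Im a, Re a, 2 (Re a Im c - Im a Re c), 0;
     0, 0, |a|², 0; Re c, Im c, |c|², 1]`

of determinant `|a|⁴ = (Complex.normSq a)²` (Laplace expansion along the first row).  Hence the
form is a relative invariant of weight `|a|⁴`; in particular translations, rotations and
dilations never change its sign, i.e. they flip no Delaunay diagonal.
-/

namespace Summit.CriticalPhenomena.CardyFormulaZ2.Theorems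

/-- **Stub S6 (card C).** The Delaunay cocircularity determinant (rows `(Re zᵢ, Im zᵢ, |zᵢ|², 1)`)
is a relative invariant of weight `|a|⁴ = (Complex.normSq a)²` under the similarities
`w ↦ a w + c` of the plane. [folklore] -/
theorem cocirc_det_similarity (z : Fin 4 → ℂ) (a c : ℂ) :
    Matrix.det (Matrix.of fun i j =>
        (![(a * z i + c).re, (a * z i + c).im, Complex.normSq (a * z i + c), 1] : Fin 4 → ℝ) j)
      = Complex.normSq a ^ 2 * Matrix.det (Matrix.of fun i j =>
        (![(z i).re, (z i).im, Complex.normSq (z i), 1] : Fin 4 → ℝ) j) := by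
  -- the matrix by which the similarity `w ↦ a w + c` acts (on the right) on the columns
  -- `(Re, Im, |·|², 1)` of the cocircularity matrix
  let N : Matrix (Fin 4) (Fin 4) ℝ :=
    !![a.re, a.im, 2 * (a.re * c.re + a.im * c.im), 0;
       -a.im, a.re, 2 * (a.re * c.im - a.im * c.re), 0;
       0, 0, Complex.normSq a, 0;
       c.re, c.im, Complex.normSq c, 1]
  -- the cocircularity matrix of the transformed points factors through `N`
  have hprod : (Matrix.of fun i j =>
        (![(a * z i + c).re, (a * z i + c).im, Complex.normSq (a * z i + c), 1] : Fin 4 → ℝ) j)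
      = (Matrix.of fun i j => (![(z i).re, (z i).im, Complex.normSq (z i), 1] : Fin 4 → ℝ) j)
          * N := by
    ext i j
    fin_cases j <;> simp [N, Matrix.mul_apply, Fin.sum_univ_four, Complex.normSq_apply] <;> ring
  -- `det N = |a|⁴`, by Laplace expansion along the first row
  have hdet : N.det = Complex.normSq a ^ 2 := by
    have h1 : Fin.succAbove (1 : Fin 4) (2 : Fin 3) = 3 := by decide
    have h2 : Fin.succAbove (2 : Fin 4) (2 : Fin 3) = 3 := by decide
    rw [Matrix.det_succ_row_zero]
    simp [N, Fin.sum_univ_succ, Matrix.det_fin_three, Complex.normSq_apply, h1, h2]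
    ring
  rw [hprod, Matrix.det_mul, hdet, mul_comm]

end Summit.CriticalPhenomena.CardyFormulaZ2.Theorems
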